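import Literature.Computability.Complexity.LadnerResolve
import HarnessLib

/-!
# Ladner's theorem: the looking-back diagonalizer and the discharge

Last layer of the discharge of `Literature.Computability.Complexity.ladner` (`StructuralPH.lean`;
Ladner 1975, Thm. 1; Homer–Selman 2011, Cor. 7.4). It supplies the hypothesis
`Ladner.IsDiagonalizer` of `LadnerArgument.lean` for every `A ∈ NP`: the function `g` of the
looking-back diagonalization (Ladner 1975, §3, the function `T`; Homer–Selman 2011, Lemma 7.1 and
the `f` of Thm. 7.6; Chew–Machtey 1981, §2, `lbw`), DEFINED by a polynomial-time machine. The
machine keeps a state `⟨tbl, ⟨c, ⟨typ, z⟩⟩⟩` — the parities of `g 0, …, g n`, the current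
requirement `(c, typ)` (`c = cand (k/2)`, `typ = [k even]` for requirement `k = g n`) and the current
candidate witness `z = cand j` — and at stage `n` performs one budgeted look back
(`Ladner.resolveFn`, `LadnerResolve.lean`): over budget nothing moves; a refuted candidate is
replaced by the next string; a certified witness advances the requirement (`g` steps) and resets the
candidate. This file:

* defines the semantic orbit `Ladner.seqD` (state `Ladner.DState`, stage `Ladner.stageSem`) and
  `Ladner.gD n = (seqD n).k`, with the table invariant (`tbl[i] = [g i odd]`, `getD_tbl_seqD`);
* builds the stage as one `FP` brick `Ladner.stageFn` of constant growth, shows that its clocked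
  orbit from `⟨x, initial state⟩` is the semantic orbit (`iterate_stageFn`), and concludes
  `{x | g |x| even} ∈ P` (`Ladner.even_gD_mem_P`);
* proves soundness and liveness of the look back against the final `g` (`res_sound`: a certified
  bit is the disagreement test `Ladner.wit`, memberships in `B` read through the table being the
  true ones; `gD_live`: the count does not stay at a witnessed requirement, since from the stage it
  was reached the candidates are examined one by one, each within finitely many stages once the
  budget affords it), whence `Ladner.isDiagonalizer_gD`;
* assembles **`Ladner.ladner_holds'`** from `ladner_of`, `isPresentationOfP_stdLp`,
  `isCookPresentation_stdNrun`, the surjectivity of `cand` and `isDiagonalizer_gD`.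

## References

* R. E. Ladner, *On the structure of polynomial time reducibility*, J. ACM 22 (1975) 155–171,
  Thm. 1, §3. doi:10.1145/321864.321877
* S. Homer, A. L. Selman, *Computability and Complexity Theory*, 2nd ed., Springer 2011, Lemma 7.1,
  Thm. 7.6, Lemma 7.2, Cor. 7.4 (pp. 141–145). doi:10.1007/978-1-4614-0682-2
* P. Chew, M. Machtey, *A note on structure and looking back applied to the relative complexity of
  computable functions*, JCSS 22 (1981) 53–59, §2. doi:10.1016/0022-0000(81)90021-0
* U. Schöning, *A uniform approach to obtain diagonal sets in complexity classes*, TCS 18 (1982)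
  95–103.
-/

noncomputable section

namespace Literature.Computability.Complexity

open _root_.Computability Polynomial Brick Nondeterministic Classes
open HashBricks (headBitFn headBitFn_apply headBitFn_mem_FP oneBit_headBitFn xorFn xorFn_apply xorFn_mem_FP
  oneBit_xorFn)
open PolyExistsEnum (next cand)

namespace Ladner

/-! ### The semantic orbit -/

/-- The state of the diagonalizer: the table of parities of `g 0, …, g n`, the requirement index
`k = g n` and the candidate index `j`. [cite: HomerSelman2011, Thm. 7.6 (proof)] -/
structure DState where
  /-- parities `[g i odd]`, `i ≤ n` -/
  tbl : List Bool
  /-- the current requirement `k = g n` -/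
  k : ℕ
  /-- the index of the current candidate witness `cand j` -/
  j : ℕ

section Orbit

variable (χ : List Bool → List Bool) (p : Polynomial ℕ) (U : Language Bool)

/-- The look back of a state: `resolveSem` at the coded requirement and candidate. [folklore] -/
def res (σ : DState) : Option Bool :=
  resolveSem χ p U σ.tbl (cand (σ.k / 2)) (decide (Even σ.k)) (cand σ.j)

/-- **One stage**: over budget nothing moves; a refuted candidate is replaced by the next one; a
certified witness advances the requirement and resets the candidate; the table records the new
parity. [cite: HomerSelman2011, Thm. 7.6 (proof) with Lemma 7.1] -/
def stageSem (σ : DState) : DState :=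
  match res χ p U σ with
  | none => ⟨σ.tbl ++ [σ.tbl.getLastD false], σ.k, σ.j⟩
  | some false => ⟨σ.tbl ++ [σ.tbl.getLastD false], σ.k, σ.j + 1⟩
  | some true => ⟨σ.tbl ++ [!σ.tbl.getLastD false], σ.k + 1, 0⟩

/-- The initial state: `g 0 = 0` (even), requirement `0`, candidate `0`. [folklore] -/
def initD : DState := ⟨[false], 0, 0⟩

/-- **The orbit** of the diagonalizer. [folklore] -/
def seqD (n : ℕ) : DState := (stageSem χ p U)^[n] initD

/-- **The diagonalizer** `g n`: the requirement reached after `n` stages. [cite: HomerSelman2011, Thm. 7.6 (proof: the function f)] -/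
def gD (n : ℕ) : ℕ := (seqD χ p U n).k

/-- The orbit, one stage further. [folklore] -/
theorem seqD_succ (n : ℕ) : seqD χ p U (n + 1) = stageSem χ p U (seqD χ p U n) :=
  Function.iterate_succ_apply' _ _ _

/-- `g 0 = 0`. [folklore] -/
theorem gD_zero : gD χ p U 0 = 0 := rfl

/-- One stage moves the requirement by at most one, according to the look back. [folklore] -/
theorem gD_succ (n : ℕ) : gD χ p U (n + 1) = gD χ p U n + (if res χ p U (seqD χ p U n) = some true then 1 else 0) := by
  simp only [gD, seqD_succ, stageSem]
  rcases h : res χ p U (seqD χ p U n) with _ | ⟨_ | _⟩ <;> simp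

/-- `g` is nondecreasing. [folklore] -/
theorem gD_mono (n : ℕ) : gD χ p U n ≤ gD χ p U (n + 1) := by
  rw [gD_succ]; omega

/-- `g` steps by at most one. [folklore] -/
theorem gD_step (n : ℕ) : gD χ p U (n + 1) ≤ gD χ p U n + 1 := by
  rw [gD_succ]; split_ifs <;> omega

/-- `g n ≤ n`. [folklore] -/
theorem gD_le (n : ℕ) : gD χ p U n ≤ n := by
  induction n with
  | zero => simp [gD_zero]
  | succ n ih => have := gD_step χ p U n; omega

/-- The motion of the candidate index on a look-back result: kept, bumped, or reset. [folklore] -/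
def bumpJ (r : Option Bool) (j : ℕ) : ℕ :=
  match r with
  | none => j
  | some false => j + 1
  | some true => 0

/-- The candidate index after one stage. [folklore] -/
theorem j_seqD_succ (n : ℕ) : (seqD χ p U (n + 1)).j = bumpJ (res χ p U (seqD χ p U n)) (seqD χ p U n).j := by
  simp only [seqD_succ, stageSem]
  rcases h : res χ p U (seqD χ p U n) with _ | ⟨_ | _⟩ <;> simp [bumpJ]

/-- The table after one stage: the new parity appended. [folklore] -/
theorem tbl_seqD_succ (n : ℕ) : (seqD χ p U (n + 1)).tbl =
    (seqD χ p U n).tbl ++ [if res χ p U (seqD χ p U n) = some true then !(seqD χ p U n).tbl.getLastD false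
      else (seqD χ p U n).tbl.getLastD false] := by
  simp only [seqD_succ, stageSem]
  rcases h : res χ p U (seqD χ p U n) with _ | ⟨_ | _⟩ <;> simp

/-- The table has `n + 1` entries at stage `n`. [folklore] -/
theorem length_tbl_seqD (n : ℕ) : (seqD χ p U n).tbl.length = n + 1 := by
  induction n with
  | zero => rfl
  | succ n ih => rw [tbl_seqD_succ, List.length_append, ih]; rfl

/-- The last entry of the table is the parity of `g n`. [folklore] -/
theorem getLastD_tbl_seqD (n : ℕ) : (seqD χ p U n).tbl.getLastD false = !decide (Even (gD χ p U n)) := by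
  induction n with
  | zero => simp [seqD, initD, gD]
  | succ n ih =>
    rw [tbl_seqD_succ, List.getLastD_eq_getLast?, List.getLast?_append, gD_succ]
    simp only [List.getLast?_singleton, Option.some_or, Option.getD_some]
    split_ifs with h
    · rw [ih]; simp [Nat.even_add_one, -Nat.not_even_iff_odd]
    · rw [ih]; simp

/-- **The table invariant**: entry `i ≤ n` of the table at stage `n` is `[g i odd]`. [cite: HomerSelman2011, Thm. 7.6 (proof)] -/
theorem getD_tbl_seqD (n : ℕ) : ∀ i ≤ n, (seqD χ p U n).tbl.getD i false = !decide (Even (gD χ p U i)) := by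
  induction n with
  | zero =>
    intro i hi
    obtain rfl : i = 0 := by omega
    simp [seqD, initD, gD]
  | succ n ih =>
    intro i hi
    have hlen := length_tbl_seqD χ p U n
    rcases Nat.lt_or_ge i (n + 1) with hlt | hge
    · rw [tbl_seqD_succ, List.getD_append _ _ _ _ (by omega)]
      exact ih i (by omega)
    · obtain rfl : i = n + 1 := by omega
      have hlast := getLastD_tbl_seqD χ p U (n + 1)
      rw [List.getLastD_eq_getLast?, List.getLast?_eq_getElem?, length_tbl_seqD] at hlast
      rw [List.getD_eq_getElem?_getD]
      simpa using hlast

end Orbit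

/-! ### The stage as one `FP` brick -/

section StageBrick

variable (χ : List Bool → List Bool) (p : Polynomial ℕ) (χU : List Bool → List Bool)

/-! Record `ρ = ⟨x, ⟨tbl, ⟨c, ⟨typ, z⟩⟩⟩⟩`: fields `nthF 0 … nthF 3`, `sndPow 3`. -/

/-- `[the look back succeeded]`. [folklore] -/
def someC : List Bool → List Bool := headBitFn ∘ resolveFn χ p χU

/-- `[the certified bit]` (junk `0` when the look back did not succeed). [folklore] -/
def valC : List Bool → List Bool := headBitFn ∘ List.tail ∘ resolveFn χ p χU

/-- `[a witness was certified]`. [folklore] -/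
def jumpC : List Bool → List Bool := andFn (someC χ p χU) (valC χ p χU)

/-- The type bit of the current requirement. [folklore] -/
def typC : List Bool → List Bool := headBitFn ∘ nthF 3

/-- The last parity of the table. [folklore] -/
def lastC : List Bool → List Bool := notFn (lastFalseF ∘ nthF 1)

/-- The new table: the new parity (flipped on a certified witness) appended. [folklore] -/
def tblN : List Bool → List Bool := fun ρ => nthF 1 ρ ++ xorFn (lastC) (jumpC χ p χU) ρ

/-- The new requirement code: advanced past an odd requirement on a certified witness. [folklore] -/
def codeN : List Bool → List Bool :=
  iteFn (jumpC χ p χU) (iteFn typC (nthF 2) (nextFn ∘ nthF 2)) (nthF 2)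

/-- The new type bit: flipped on a certified witness. [folklore] -/
def typN : List Bool → List Bool := iteFn (jumpC χ p χU) (notFn typC) typC

/-- The new candidate: reset on a certified witness, the next string on a refuted candidate, kept
over budget. [folklore] -/
def candN : List Bool → List Bool :=
  iteFn (someC χ p χU) (iteFn (valC χ p χU) (fun _ => []) (nextFn ∘ sndPow 3)) (sndPow 3)

/-- **The stage brick**. [cite: HomerSelman2011, Thm. 7.6 (proof) with Lemma 7.1] -/
def stageFn : List Bool → List Bool :=
  fanoutFn (nthF 0) (fanoutFn (tblN χ p χU) (fanoutFn (codeN χ p χU) (fanoutFn (typN χ p χU) (candN χ p χU))))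

variable {χ χU}

/-- `stageFn ∈ FP` for `χ, χU ∈ FP`. [cite: AroraBarakCC2009, §1.3] -/
theorem stageFn_mem_FP (hχ : χ ∈ FP) (hU : χU ∈ FP) : stageFn χ p χU ∈ FP := by
  have hr := resolveFn_mem_FP p hχ hU
  have hsome : someC χ p χU ∈ FP := comp_mem_FP headBitFn_mem_FP hr
  have hval : valC χ p χU ∈ FP := comp_mem_FP headBitFn_mem_FP (comp_mem_FP PRelSigma.tail_mem_FP hr)
  have hjump : jumpC χ p χU ∈ FP := andFn_mem_FP hsome hval
  have htyp : typC ∈ FP := comp_mem_FP headBitFn_mem_FP (nthF_mem_FP 3)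
  have hlast : lastC ∈ FP := notFn_mem_FP (comp_mem_FP lastFalseF_mem_FP (nthF_mem_FP 1))
  refine fanoutFn_mem_FP (nthF_mem_FP 0) (fanoutFn_mem_FP (append_mem_FP (nthF_mem_FP 1) (xorFn_mem_FP hlast hjump))
    (fanoutFn_mem_FP (iteFn_mem_FP hjump (iteFn_mem_FP htyp (nthF_mem_FP 2) (comp_mem_FP nextFn_mem_FP (nthF_mem_FP 2)))
      (nthF_mem_FP 2)) (fanoutFn_mem_FP (iteFn_mem_FP hjump (notFn_mem_FP htyp) htyp)
      (iteFn_mem_FP hsome (iteFn_mem_FP hval (const_mem_FP _) (comp_mem_FP nextFn_mem_FP (sndPow_mem_FP 3)))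
        (sndPow_mem_FP 3)))))

/-- The stage keeps the yardstick. [folklore] -/
theorem fst_stageFn (ρ : List Bool) : (boolUnpair (stageFn χ p χU ρ)).1 = (boolUnpair ρ).1 := by
  simp [stageFn, nthF, fstF]

/-- **Growth of the stage**: `|stageFn ρ| ≤ |ρ| + 16` on every input. [folklore] -/
theorem length_stageFn_le (ρ : List Bool) :
    (stageFn χ p χU ρ).length ≤ ρ.length + 16 * ((boolUnpair ρ).1.length + 1) := by
  have e0 : nthF 0 ρ = fstF ρ := rfl
  have e1 : nthF 1 ρ = fstF (sndF ρ) := rfl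
  have e2 : nthF 2 ρ = fstF (sndF (sndF ρ)) := rfl
  have e3 : nthF 3 ρ = fstF (sndF (sndF (sndF ρ))) := rfl
  have e4 : sndPow 3 ρ = sndF (sndF (sndF (sndF ρ))) := rfl
  have h0 := length_fstF_sndF_le ρ
  have h1 := length_fstF_sndF_le (sndF ρ)
  have h2 := length_fstF_sndF_le (sndF (sndF ρ))
  have h3 := length_fstF_sndF_le (sndF (sndF (sndF ρ)))
  have hjump : OneBit (jumpC χ p χU) := oneBit_andFn (oneBit_headBitFn.comp _) (oneBit_headBitFn.comp _)
  have htyp : OneBit typC := oneBit_headBitFn.comp _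
  have hsome : OneBit (someC χ p χU) := oneBit_headBitFn.comp _
  have hval : OneBit (valC χ p χU) := oneBit_headBitFn.comp _
  have hx : OneBit (xorFn lastC (jumpC χ p χU)) := oneBit_xorFn (oneBit_notFn (oneBit_lastFalseF.comp _)) hjump
  have htbl : (tblN χ p χU ρ).length = (nthF 1 ρ).length + 1 := by
    rw [tblN, List.length_append, hx.length_eq]
  have hcode : (codeN χ p χU ρ).length ≤ (nthF 2 ρ).length + 1 := by
    unfold codeN
    rw [iteFn_of_oneBit hjump]
    split_ifs
    · rw [iteFn_of_oneBit htyp]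
      split_ifs
      · omega
      · show (nextFn (nthF 2 ρ)).length ≤ _
        rw [nextFn_apply]; exact OrbitDecider.Exists.length_next_le _
    · omega
  have htypN : (typN χ p χU ρ).length = 1 := (hjump.ite (oneBit_notFn htyp) htyp).length_eq ρ
  have hcand : (candN χ p χU ρ).length ≤ (sndPow 3 ρ).length + 1 := by
    unfold candN
    rw [iteFn_of_oneBit hsome]
    split_ifs
    · rw [iteFn_of_oneBit hval]
      split_ifs
      · simp
      · show (nextFn (sndPow 3 ρ)).length ≤ _
        rw [nextFn_apply]; exact OrbitDecider.Exists.length_next_le _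
    · omega
  unfold stageFn
  rw [length_fanoutFn, length_fanoutFn, length_fanoutFn, length_fanoutFn, htbl, htypN]
  rw [e0, e1, e2] at *
  rw [e4] at hcand
  simp only [fstF, sndF] at *
  omega

/-- The coded state `⟨tbl, ⟨cand (k/2), ⟨[k even], cand j⟩⟩⟩`. [folklore] -/
def encD (σ : DState) : List Bool :=
  boolPair σ.tbl (boolPair (cand (σ.k / 2)) (boolPair [decide (Even σ.k)] (cand σ.j)))

/-- Advancing the requirement: `cand ((k+1)/2)` is `cand (k/2)` for even `k` and its successor
for odd `k`. [folklore] -/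
theorem cand_succ_div_two (k : ℕ) :
    cand ((k + 1) / 2) = if Even k then cand (k / 2) else next (cand (k / 2)) := by
  split_ifs with h
  · obtain ⟨i, rfl⟩ := h
    congr 1; omega
  · obtain ⟨i, rfl⟩ := Nat.not_even_iff_odd.1 h
    rw [show (2 * i + 1 + 1) / 2 = i + 1 by omega, show (2 * i + 1) / 2 = i by omega]
    exact PolyExistsEnum.cand_succ i

/-- **Value of the stage brick** on a coded state with a long yardstick: the coded next state.
[cite: HomerSelman2011, Thm. 7.6 (proof)] -/
theorem stageFn_apply {U : Language Bool} (x : List Bool) (σ : DState) (hne : σ.tbl ≠ [])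
    (htbl : σ.tbl.length ≤ x.length) (hc : (cand (σ.k / 2)).length ≤ x.length) :
    stageFn χ p (fun w => [U.boolIndicator w]) (boolPair x (encD σ)) =
      boolPair x (encD (stageSem χ p U σ)) := by
  set ρ := boolPair x (encD σ) with hρ
  have hres : resolveFn χ p (fun w => [U.boolIndicator w]) ρ = encOpt (res χ p U σ) :=
    resolveFn_apply x σ.tbl (cand (σ.k / 2)) (cand σ.j) (decide (Even σ.k)) htbl hc
  have f0 : nthF 0 ρ = x := by simp [hρ, encD, nthF]
  have f1 : nthF 1 ρ = σ.tbl := by simp [hρ, encD, nthF]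
  have f2 : nthF 2 ρ = cand (σ.k / 2) := by simp [hρ, encD, nthF]
  have f3 : nthF 3 ρ = [decide (Even σ.k)] := by simp [hρ, encD, nthF]
  have f4 : sndPow 3 ρ = cand σ.j := by simp [hρ, encD, sndPow]
  have htypC : typC ρ = [decide (Even σ.k)] := by simp [typC, Function.comp_apply, f3, headBitFn_apply]
  have hlastC : lastC ρ = [σ.tbl.getLastD false] := by
    obtain ⟨l, b, hlb⟩ := List.eq_nil_or_concat σ.tbl |>.resolve_left hne
    unfold lastC
    rw [notFn_apply (b := decide (σ.tbl.getLast? = some false))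
      (by simp [Function.comp_apply, f1, lastFalseF_apply])]
    rw [hlb]; cases b <;> simp
  -- the three outcomes of the look back
  rcases hr : res χ p U σ with _ | ⟨_ | _⟩
  · -- over budget
    have hs : someC χ p (fun w => [U.boolIndicator w]) ρ = [false] := by
      simp [someC, Function.comp_apply, hres, hr, encOpt, headBitFn_apply]
    have hv : valC χ p (fun w => [U.boolIndicator w]) ρ = [false] := by
      simp [valC, Function.comp_apply, hres, hr, encOpt, headBitFn_apply]
    have hj : jumpC χ p (fun w => [U.boolIndicator w]) ρ = [false] := by rw [jumpC, andFn_apply hs hv]; rfl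
    simp only [stageFn, fanoutFn_apply, f0, tblN, f1, xorFn_apply hlastC hj, codeN, iteFn_apply_false hj, f2,
      typN, htypC, candN, iteFn_apply_false hs, f4, stageSem, hr, encD, Bool.xor_false]
  · -- refuted candidate
    have hs : someC χ p (fun w => [U.boolIndicator w]) ρ = [true] := by
      simp [someC, Function.comp_apply, hres, hr, encOpt, headBitFn_apply]
    have hv : valC χ p (fun w => [U.boolIndicator w]) ρ = [false] := by
      simp [valC, Function.comp_apply, hres, hr, encOpt, headBitFn_apply]
    have hj : jumpC χ p (fun w => [U.boolIndicator w]) ρ = [false] := by rw [jumpC, andFn_apply hs hv]; rfl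
    simp only [stageFn, fanoutFn_apply, f0, tblN, f1, xorFn_apply hlastC hj, codeN, iteFn_apply_false hj, f2,
      typN, htypC, candN, iteFn_apply_true hs, iteFn_apply_false hv, Function.comp_apply, f4, nextFn_apply,
      stageSem, hr, encD, Bool.xor_false, PolyExistsEnum.cand_succ]
  · -- certified witness
    have hs : someC χ p (fun w => [U.boolIndicator w]) ρ = [true] := by
      simp [someC, Function.comp_apply, hres, hr, encOpt, headBitFn_apply]
    have hv : valC χ p (fun w => [U.boolIndicator w]) ρ = [true] := by
      simp [valC, Function.comp_apply, hres, hr, encOpt, headBitFn_apply]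
    have hj : jumpC χ p (fun w => [U.boolIndicator w]) ρ = [true] := by rw [jumpC, andFn_apply hs hv]; rfl
    have hcode : codeN χ p (fun w => [U.boolIndicator w]) ρ = cand ((σ.k + 1) / 2) := by
      rw [codeN, iteFn_apply_true hj, cand_succ_div_two]
      by_cases he : Even σ.k
      · rw [iteFn_apply_true (by rw [htypC]; simp [he]), if_pos he, f2]
      · rw [iteFn_apply_false (by rw [htypC]; simp [he]), if_neg he]
        simp [Function.comp_apply, f2]
    have htypN : typN χ p (fun w => [U.boolIndicator w]) ρ = [decide (Even (σ.k + 1))] := by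
      rw [typN, iteFn_apply_true hj, notFn_apply htypC]
      simp [Nat.even_add_one, -Nat.not_even_iff_odd]
    simp only [stageFn, fanoutFn_apply, f0, tblN, f1, xorFn_apply hlastC hj, hcode, htypN, candN,
      iteFn_apply_true hs, iteFn_apply_true hv, stageSem, hr, encD, Bool.xor_true]
    rfl

end StageBrick

/-! ### The clocked orbit of the brick is the semantic orbit; `{x | g |x| even} ∈ P` -/

section Machine

variable (χ : List Bool → List Bool) (p : Polynomial ℕ) (U : Language Bool)

/-- The indicator brick of `U`. [folklore] -/
def indU : List Bool → List Bool := fun w => [U.boolIndicator w]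

/-- The indicator brick of a language of `P` is in `FP` (`indicatorFn_mem_FP`). [folklore] -/
theorem indU_mem_FP (hU : U ∈ Classes.P) : indU U ∈ FP := indicatorFn_mem_FP hU

/-- The initial record `⟨x, coded initial state⟩`. [folklore] -/
def initFn : List Bool → List Bool := fanoutFn id (fun _ => encD initD)

/-- The clocked orbit: `|x|` stages. [cite: AroraBarakCC2009, §1.4.1 (clocked loops)] -/
def orbitFn : List Bool → List Bool :=
  fun ρ => (stageFn χ p (indU U))^[(X : Polynomial ℕ).eval (boolUnpair ρ).1.length] ρ

/-- **The parity decider**: `x ↦ [last parity of the table after |x| stages = 0] = [g |x| even]`.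
[cite: HomerSelman2011, Lemma 7.1 (G[f] ∈ P)] -/
def parityDecider : List Bool → List Bool := lastFalseF ∘ nthF 1 ∘ orbitFn χ p U ∘ initFn

variable {χ U}

/-- `parityDecider ∈ FP` (clocked iteration of a constant-growth stage, `iterate_mem_FP_of_growth`).
[cite: AroraBarakCC2009, §1.4.1] -/
theorem parityDecider_mem_FP (hχ : χ ∈ FP) (hU : U ∈ Classes.P) : parityDecider χ p U ∈ FP :=
  comp_mem_FP lastFalseF_mem_FP (comp_mem_FP (nthF_mem_FP 1) (comp_mem_FP
    (iterate_mem_FP_of_growth (stageFn_mem_FP p hχ (indU_mem_FP U hU)) 16 (fst_stageFn p) (length_stageFn_le p) X)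
    (fanoutFn_mem_FP OracleCompose.id_mem_FP (const_mem_FP _))))

/-- **The clocked orbit is the semantic orbit**, as long as the yardstick affords the stages.
[cite: HomerSelman2011, Thm. 7.6 (proof)] -/
theorem iterate_stageFn (x : List Bool) : ∀ n ≤ x.length,
    (stageFn χ p (indU U))^[n] (boolPair x (encD initD)) = boolPair x (encD (seqD χ p U n))
  | 0, _ => rfl
  | n + 1, hn => by
    rw [Function.iterate_succ_apply', iterate_stageFn x n (by omega), seqD_succ]
    refine stageFn_apply (p := p) x (seqD χ p U n) ?_ ?_ ?_
    · rw [← List.length_pos_iff_ne_nil, length_tbl_seqD]; omega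
    · rw [length_tbl_seqD]; omega
    · have h1 := length_cand_le (gD χ p U n / 2)
      have h2 := gD_le χ p U n
      have : gD χ p U n / 2 ≤ gD χ p U n := Nat.div_le_self _ _
      show (cand (gD χ p U n / 2)).length ≤ x.length
      omega

/-- **Value of the parity decider.** [cite: HomerSelman2011, Lemma 7.1] -/
theorem parityDecider_apply (x : List Bool) : parityDecider χ p U x = [decide (Even (gD χ p U x.length))] := by
  have horb : orbitFn χ p U (initFn x) = boolPair x (encD (seqD χ p U x.length)) := by
    simp only [orbitFn, initFn, fanoutFn_apply, id, boolUnpair_boolPair, eval_X]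
    exact iterate_stageFn p x x.length le_rfl
  have hlast := getLastD_tbl_seqD χ p U x.length
  have hne : (seqD χ p U x.length).tbl ≠ [] := by
    rw [← List.length_pos_iff_ne_nil, length_tbl_seqD]; omega
  obtain ⟨l, b, hlb⟩ := (List.eq_nil_or_concat _).resolve_left hne
  rw [List.concat_eq_append] at hlb
  have hb : b = !decide (Even (gD χ p U x.length)) := by simpa [hlb] using hlast
  simp only [parityDecider, Function.comp_apply, horb, encD, nthF, fstF_boolPair, sndF_boolPair, lastFalseF_apply]
  rw [hlb]
  subst hb
  simp

/-- **The parity language of the diagonalizer is in `P`.** [cite: HomerSelman2011, Lemma 7.1 (G[f] ∈ P)] -/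
theorem even_gD_mem_P (hχ : χ ∈ FP) (hU : U ∈ Classes.P) :
    ({x | Even (gD χ p U x.length)} : Language Bool) ∈ Classes.P :=
  mem_P_of_mem_FP (parityDecider_mem_FP p hχ hU) _ fun w =>
    ⟨fun hw => by
      have hw' : Even (gD χ p U w.length) := hw
      rw [parityDecider_apply, decide_eq_true hw'],
     fun hw => by
      have hw' : ¬ Even (gD χ p U w.length) := hw
      rw [parityDecider_apply, decide_eq_false hw']⟩

end Machine

/-! ### Soundness of the look back against the final `g` -/

section Sound

variable {A R : Language Bool} {pR : Polynomial ℕ}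

/-- The indicator brick of the verifier language. [folklore] -/
def indR (R : Language Bool) : List Bool → List Bool := fun w => [R.boolIndicator w]

open Classical in
/-- **The certificate search decides `A`** (given a verifier `R` of `A` with bound `pR`).
[cite: AroraBarakCC2009, Def. 2.1 and Claim 2.4] -/
theorem Asem_eq (hA : ∀ w, w ∈ A ↔ ∃ y : List Bool, y.length ≤ pR.eval w.length ∧ boolPair w y ∈ R)
    (w : List Bool) : Asem (indR R) pR w = A.boolIndicator w := by
  unfold Asem indR
  have key : (∃ y : List Bool, y.length ≤ pR.eval w.length ∧ [R.boolIndicator (boolPair w y)].headD false = true) ↔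
      w ∈ A := by
    rw [hA]
    simp only [List.headD_cons]
    exact exists_congr fun y => and_congr_right fun _ => (Set.mem_iff_boolIndicator R _).symm
  by_cases hw : w ∈ A
  · rw [decide_eq_true (key.2 hw), (Set.mem_iff_boolIndicator A w).1 hw]
  · rw [decide_eq_false (fun h => hw (key.1 h)), (Set.notMem_iff_boolIndicator A w).1 hw]

variable (hA : ∀ w, w ∈ A ↔ ∃ y : List Bool, y.length ≤ pR.eval w.length ∧ boolPair w y ∈ R)
include hA

/-- **The looked-back oracle bit is membership in `B = blend A g`** inside the table range.
[cite: HomerSelman2011, Thm. 7.6 (proof)] -/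
theorem Osem_eq (U : Language Bool) (n : ℕ) (w : List Bool) (hw : w.length ≤ n) :
    Osem (indR R) pR (seqD (indR R) pR U n).tbl w = (blend A (gD (indR R) pR U)).boolIndicator w := by
  rw [Osem, Asem_eq hA, getD_tbl_seqD _ _ _ n _ hw, Bool.not_not]
  have hb : w ∈ blend A (gD (indR R) pR U) ↔ Even (gD (indR R) pR U w.length) ∧ w ∈ A := mem_blend_iff
  by_cases h : w ∈ blend A (gD (indR R) pR U)
  · rw [(Set.mem_iff_boolIndicator _ w).1 h, (Set.mem_iff_boolIndicator A w).1 (hb.1 h).2,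
      decide_eq_true (hb.1 h).1]; rfl
  · rw [(Set.notMem_iff_boolIndicator _ w).1 h]
    by_cases hwA : w ∈ A
    · have : ¬ Even (gD (indR R) pR U w.length) := fun he => h (hb.2 ⟨he, hwA⟩)
      rw [decide_eq_false this]; simp
    · rw [(Set.notMem_iff_boolIndicator A w).1 hwA]; simp

omit hA in
/-- The core algorithm runs identically against two oracles agreeing on the short queries.
[folklore] -/
theorem runAux_oracle_congr (e : List Bool) (K₁ K₂ : ℕ) {O₁ O₂ : Oracle} (x : List Bool)
    (hO : ∀ y : List Bool, y.length ≤ K₁ → O₁ y = O₂ y) :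
    ∀ (f : ℕ) (as : List (List Bool)),
      (procCore e K₁ K₂).runAux O₁ x f as = (procCore e K₁ K₂).runAux O₂ x f as
  | 0, _ => rfl
  | f + 1, as => by
    rw [OracleAlg.runAux_succ, OracleAlg.runAux_succ]
    dsimp only [procCore]
    cases hs : stepSemCore e K₁ K₂ x as with
    | inr b => rfl
    | inl y =>
      dsimp only
      rw [hO y (length_query_le_core hs)]
      exact runAux_oracle_congr e K₁ K₂ x hO f _

/-- **Soundness of the look back**: a bit certified at stage `n` is the disagreement test
`Ladner.wit` of the current requirement `g n` at the current candidate, against the FINAL `g` —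
memberships in `B` were read through the table at lengths `≤ n`, where the table is the parity of
the final `g`, and the simulated procedure only queried such lengths.
[cite: HomerSelman2011, Thm. 7.6 (proof: "z ∈ L(M_j) △ A")] -/
theorem res_sound (n : ℕ) {b : Bool} (h : res (indR R) pR stdAcc (seqD (indR R) pR stdAcc n) = some b) :
    wit A stdLp stdNrun cand (gD (indR R) pR stdAcc) (gD (indR R) pR stdAcc n)
      (cand (seqD (indR R) pR stdAcc n).j) = b := by
  set g := gD (indR R) pR stdAcc with hg
  set σ := seqD (indR R) pR stdAcc n with hσ
  set k := g n with hk
  set c := cand (k / 2) with hc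
  set z := cand σ.j with hz
  set kk := (boolUnpair c).2.length with hkk
  have hσk : σ.k = k := rfl
  -- the look back succeeded, so the budget afforded it
  unfold res resolveSem at h
  simp only [hσk, ← hc, ← hz, ← hkk] at h
  by_cases hAff : Afford pR (σ.tbl.length - 1) kk z
  swap
  · rw [if_neg hAff] at h; cases h
  rw [if_pos hAff] at h
  obtain ⟨hA1, -, -⟩ := hAff
  have hlen : σ.tbl.length = n + 1 := length_tbl_seqD _ _ _ n
  rw [hlen, Nat.add_sub_cancel] at hA1
  have hzK : z.length < clock₁ kk z := length_lt_clock₁ kk z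
  have hzn : z.length ≤ n := by omega
  simp only [Option.some.injEq] at h
  subst h
  unfold wit
  by_cases he : Even k
  · rw [if_pos he, if_pos (decide_eq_true he), Osem_eq hA stdAcc n z hzn, ← hg,
      boolIndicator_eq_of_iff (mem_stdLp_iff (c := c) (z := z))]
  · -- the simulated run is the run of the presented procedure with oracle `B`
    have hO : ∀ y : List Bool, y.length ≤ clock₁ kk z →
        (fun y => [Osem (indR R) pR σ.tbl y]) y = Oracle.ofLanguage (blend A g) y := by
      intro y hy
      show [Osem (indR R) pR σ.tbl y] = encodeBool ((blend A g).boolIndicator y)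
      rw [Osem_eq hA stdAcc n y (by omega), ← hg]
      rfl
    have hrun : cookSem (indR R) pR σ.tbl (boolUnpair c).1 (clock₁ kk z) (clock₂ kk z) z =
        stdNrun c (blend A g) z := by
      rw [cookSem, runAux_oracle_congr _ _ _ z hO, stdNrun, OracleAlg.run, runAux_proc]
    rw [if_neg he, if_neg (by rw [decide_eq_false he]; exact Bool.false_ne_true), Asem_eq hA, hrun]

end Sound

/-! ### Liveness: the count does not stay at a witnessed requirement -/

section Live

variable (χ : List Bool → List Bool) (p : Polynomial ℕ) (U : Language Bool)

/-- The budget eventually affords any fixed look back. [cite: ChewMachtey1981, §2] -/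
theorem afford_eventually (kk : ℕ) (z : List Bool) : ∃ m₀, ∀ m, m₀ ≤ m → Afford p m kk z := by
  refine ⟨clock₁ kk z + clock₂ kk z + 2 ^ (p.eval (clock₁ kk z) + 1), fun m hm => ?_⟩
  unfold Afford
  generalize 2 ^ (p.eval (clock₁ kk z) + 1) = d at hm ⊢
  refine ⟨?_, ?_, ?_⟩ <;> omega

/-- The look back of a state succeeds iff the budget affords it. [folklore] -/
theorem res_isSome_iff (σ : DState) :
    (res χ p U σ).isSome ↔ Afford p (σ.tbl.length - 1) (boolUnpair (cand (σ.k / 2))).2.length (cand σ.j) := by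
  unfold res resolveSem
  by_cases h : Afford p (σ.tbl.length - 1) (boolUnpair (cand (σ.k / 2))).2.length (cand σ.j)
  · rw [if_pos h]; simp [h]
  · rw [if_neg h]; simp [h]

/-- While the look backs do not succeed, the candidate stays. [folklore] -/
theorem j_eq_of_res_none {n n' : ℕ} (hnn : n ≤ n')
    (h : ∀ i, n ≤ i → i < n' → res χ p U (seqD χ p U i) = none) : (seqD χ p U n').j = (seqD χ p U n).j := by
  induction n' with
  | zero =>
    obtain rfl : n = 0 := by omega
    rfl
  | succ n' ih =>
    rcases Nat.lt_or_ge n' n with hlt | hge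
    · obtain rfl : n = n' + 1 := by omega
      rfl
    · rw [j_seqD_succ, h n' hge (by omega), bumpJ]
      exact ih hge fun i hi hi' => h i hi (by omega)

/-- While the requirement stays, from any stage some later stage has the same candidate and a
successful look back. [cite: ChewMachtey1981, §2 (looking back eventually finds witnesses)] -/
theorem exists_resolved {k n : ℕ} (hk : ∀ i, n ≤ i → gD χ p U i = k) :
    ∃ n', n ≤ n' ∧ (seqD χ p U n').j = (seqD χ p U n).j ∧ (res χ p U (seqD χ p U n')).isSome := by
  classical
  set kk := (boolUnpair (cand (k / 2))).2.length with hkk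
  obtain ⟨m₀, hm₀⟩ := afford_eventually p kk (cand (seqD χ p U n).j)
  -- the first stage `≥ n` with a successful look back, at the latest `max n (m₀ + 1)`
  have hex : ∃ n', n ≤ n' ∧ (res χ p U (seqD χ p U n')).isSome := by
    by_contra hno
    push Not at hno
    set m := max n (m₀ + 1) with hm
    have hnone : ∀ i, n ≤ i → i < m + 1 → res χ p U (seqD χ p U i) = none := fun i hi _ => by
      have := hno i hi
      cases hr : res χ p U (seqD χ p U i) with
      | none => rfl
      | some b => rw [hr] at this; simp at this
    have hj : (seqD χ p U m).j = (seqD χ p U n).j := j_eq_of_res_none χ p U (le_max_left _ _) fun i hi hi' =>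
      hnone i hi (by omega)
    have hsome : (res χ p U (seqD χ p U m)).isSome := by
      rw [res_isSome_iff, length_tbl_seqD, Nat.add_sub_cancel, hj]
      have hkm : (seqD χ p U m).k = k := hk m (le_max_left _ _)
      rw [hkm]
      exact hm₀ m (by omega)
    exact absurd hsome (by simpa using hno m (le_max_left _ _))
  let n' := Nat.find hex
  obtain ⟨hn', hsome⟩ : n ≤ n' ∧ (res χ p U (seqD χ p U n')).isSome := Nat.find_spec hex
  refine ⟨n', hn', j_eq_of_res_none χ p U hn' fun i hi hi' => ?_, hsome⟩
  have hmin := Nat.find_min hex hi'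
  cases hr : res χ p U (seqD χ p U i) with
  | none => rfl
  | some b => exact absurd ⟨hi, by simp [hr]⟩ hmin

/-- **Liveness**: if requirement `k` has a witness then `g` does not stay at `k`. Otherwise, from the
first stage `n_k` with `g = k` (where the candidate index is `0`) no look back certifies a witness,
so the candidate index takes every value: each candidate is examined until the budget affords the
look back, which then refutes it and moves to the next one; at the index of the witness the look
back would certify it (`res_sound`), a contradiction.
[cite: HomerSelman2011, Thm. 7.6 (proof) with Lemma 7.1; ChewMachtey1981, §2] -/
theorem gD_live {A R : Language Bool} {pR : Polynomial ℕ}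
    (hA : ∀ w, w ∈ A ↔ ∃ y : List Bool, y.length ≤ pR.eval w.length ∧ boolPair w y ∈ R) (k : ℕ)
    (hwit : ∃ z, wit A stdLp stdNrun cand (gD (indR R) pR stdAcc) k z = true) (n₀ : ℕ) :
    ∃ n, n₀ ≤ n ∧ gD (indR R) pR stdAcc n ≠ k := by
  classical
  set g := gD (indR R) pR stdAcc with hg
  by_contra hstuck
  push Not at hstuck
  -- from the first stage with `g = k` on, `g` stays at `k`
  have hex : ∃ n, g n = k := ⟨n₀, hstuck n₀ le_rfl⟩
  set nk := Nat.find hex with hnk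
  have hgk : g nk = k := Nat.find_spec hex
  have hmono : Monotone g := monotone_nat_of_le_succ (gD_mono _ _ _)
  have hstay : ∀ i, nk ≤ i → g i = k := by
    intro i hi
    rcases le_total i n₀ with h | h
    · have h1 := hmono hi; have h2 := hmono h; rw [hgk] at h1; rw [hstuck n₀ le_rfl] at h2; omega
    · exact hstuck i h
  -- no look back certifies a witness from `nk` on
  have hnojump : ∀ i, nk ≤ i → res (indR R) pR stdAcc (seqD (indR R) pR stdAcc i) ≠ some true := by
    intro i hi hri
    have := gD_succ (indR R) pR stdAcc i
    rw [if_pos hri] at this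
    have h1 := hstay i hi; have h2 := hstay (i + 1) (by omega)
    change g (i + 1) = g i + 1 at this
    omega
  -- the candidate index at `nk` is `0`
  have hj0 : (seqD (indR R) pR stdAcc nk).j = 0 := by
    rcases Nat.eq_zero_or_pos nk with h0 | hpos
    · rw [h0]; rfl
    · obtain ⟨m, hm⟩ : ∃ m, nk = m + 1 := ⟨nk - 1, by omega⟩
      have hlt : g m ≠ k := Nat.find_min hex (by omega)
      have hle : g m ≤ k := by rw [← hgk]; exact hmono (by omega)
      have hsucc := gD_succ (indR R) pR stdAcc m
      change g (m + 1) = g m + _ at hsucc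
      rw [← hm, hgk] at hsucc
      have hjump : res (indR R) pR stdAcc (seqD (indR R) pR stdAcc m) = some true := by
        by_contra hne; rw [if_neg hne] at hsucc; omega
      rw [hm, j_seqD_succ, hjump, bumpJ]
  -- every candidate index is reached
  have hreach : ∀ J, ∃ n, nk ≤ n ∧ (seqD (indR R) pR stdAcc n).j = J := by
    intro J
    induction J with
    | zero => exact ⟨nk, le_rfl, hj0⟩
    | succ J ih =>
      obtain ⟨n, hn, hJ⟩ := ih
      obtain ⟨n', hnn', hj', hsome⟩ := exists_resolved (indR R) pR stdAcc (k := k) (n := n)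
        (fun i hi => hstay i (by omega))
      obtain ⟨b, hb⟩ := Option.isSome_iff_exists.1 hsome
      have hbf : b = false := by
        cases b
        · rfl
        · exact absurd hb (hnojump n' (by omega))
      refine ⟨n' + 1, by omega, ?_⟩
      rw [j_seqD_succ, hb, hbf, bumpJ, hj', hJ]
  -- at the index of the witness the look back certifies it
  obtain ⟨z, hz⟩ := hwit
  obtain ⟨J, -, hJz⟩ := PolyExistsEnum.exists_cand_eq z
  obtain ⟨n, hn, hJ⟩ := hreach J
  obtain ⟨n', hnn', hj', hsome⟩ := exists_resolved (indR R) pR stdAcc (k := k) (n := n)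
    (fun i hi => hstay i (by omega))
  obtain ⟨b, hb⟩ := Option.isSome_iff_exists.1 hsome
  have hsound := res_sound hA n' hb
  rw [hj', hJ, show gD (indR R) pR stdAcc n' = k from hstay n' (by omega)] at hsound
  have hcz : cand J = z := hJz
  rw [hcz, hz] at hsound
  exact hnojump n' (by omega) (hsound ▸ hb)

end Live

/-! ### The diagonalizer and the discharge -/

/-- **The looking-back diagonalizer of a language with a polynomial-time verifier.**
[cite: HomerSelman2011, Thm. 7.6 (proof) with Lemma 7.1] -/
theorem isDiagonalizer_gD {A R : Language Bool} {pR : Polynomial ℕ} (hR : R ∈ Classes.P)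
    (hA : ∀ w, w ∈ A ↔ ∃ y : List Bool, y.length ≤ pR.eval w.length ∧ boolPair w y ∈ R) :
    IsDiagonalizer A stdLp stdNrun cand (gD (indR R) pR stdAcc) where
  zero := rfl
  mono := gD_mono _ _ _
  step := gD_step _ _ _
  even_mem_P := even_gD_mem_P pR (indicatorFn_mem_FP hR) stdAcc_mem_P
  sound n h := by
    have hsucc := gD_succ (indR R) pR stdAcc n
    have hjump : res (indR R) pR stdAcc (seqD (indR R) pR stdAcc n) = some true := by
      by_contra hne; rw [if_neg hne] at hsucc; omega
    exact ⟨_, res_sound hA n hjump⟩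
  live := gD_live hA

/-- **Every `NP` language has a diagonalizer** over the standard presentations. [cite: HomerSelman2011, Thm. 7.6] -/
theorem exists_isDiagonalizer (A : Language Bool) (hA : A ∈ NP) :
    ∃ g : ℕ → ℕ, IsDiagonalizer A stdLp stdNrun cand g := by
  obtain ⟨R, hR, pR, hAR⟩ := hA
  exact ⟨_, isDiagonalizer_gD hR hAR⟩

/-- The enumeration of strings by (length, value) is onto. [folklore] -/
theorem cand_surjective : Function.Surjective cand := fun y =>
  let ⟨k, _, hk⟩ := PolyExistsEnum.exists_cand_eq y
  ⟨k, hk⟩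

/-- **Ladner's theorem** (Ladner 1975, Thm. 1; Homer–Selman 2011, Cor. 7.4): if `P ≠ NP` then some
language of `NP ∖ P` is not `≤ᵀₚ`-hard for `NP` — the named fact `ladner` of `StructuralPH.lean`,
from `ladner_of` with the standard presentation of `P` (`isPresentationOfP_stdLp`), the standard
enumeration of the clocked oracle procedures (`isCookPresentation_stdNrun`), the enumeration of all
strings (`cand_surjective`) and the looking-back diagonalizer of every `NP` language
(`exists_isDiagonalizer`). [cite: Ladner1975, Thm. 1] -/
theorem ladner_holds' : ladner :=
  ladner_of isPresentationOfP_stdLp isCookPresentation_stdNrun cand_surjective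
    fun A hA _ => exists_isDiagonalizer A hA

end Ladner

end Literature.Computability.Complexity

end
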